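/-
Copyright (c) 2026. All rights reserved.
Released under Apache 2.0 license as described in the file LICENSE.
Authors: abc-iut cell, seat abc-iut-L4-t6 (gen 9; row «P13viii′-NODAL-IV», step CT2a).
-/
import Literature.AnabelianGeometry.AbsoluteAnabelian.AbsTopII.DehnTwistFixedSubgroupExotic
import HarnessLib

/-!
# Mixed twists `conj(b^u) ∘ shear^i(k)` of `F̂₂` with NON-INTEGRAL slope have fixed subgroup `Π_e = b^Ẑ` (CT2a)

S. Mochizuki, *Topics in Absolute Anabelian Geometry II* [AbsTopII] (`MochizukiAbsTopII2013`; kurims manuscript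
`paper:url-585b8d0ad0d9`), §1, Prop 1.3 (viii) p. 12 ("`I_v = D_e ∩ D_{e'} ∩ Π_I`").  At the nodal Dehn-twist datum
`DehnTwist.dpsc i hi` (`Π_I = F̂₂ ⋊_{shear^i} Ẑ`, loop node `e` with edge torus `D_e = b^Ẑ ⋊ Ẑ ≅ Ẑ²`), the typed
Prop 1.3 (viii′) holds MODULO «CT2» (abc-iut-L4-t6 `DehnTwistLoopProp13viiiOfCT2`, p487638): the centraliser in `Π_𝔾`
of a NON-FIBRE element `(b^u, k)` of `D_e` lies in `b^Ẑ`, i.e. `shear^i(k) x = b^{-u} x b^{u} ⇒ x ∈ Π_e` whenever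
`b^u ∉ {1, b^{k^i}}`.

PROOF-ONLY file (no definition), abc-iut-L4-t6 (gen 9).  THIS FILE PROVES THE NON-INTEGRAL-SLOPE HALF «CT2a»:
**if some level `d` of `Ẑ` kills `k^i` but not `u` (i.e. `u ∉ (k^i)·Ẑ`), then `shear^i(k) x = b^{-u} x b^u ⇒ x ∈ Π_e`**
(`mem_nodeGp_of_mixed_twist_eq`).  The residual of CT2 is thereby the INTEGRAL-slope case `u ∈ (k^i)·Ẑ ∖ {0, k^i}`
(profinite Bass–Serre territory; [CbTpII] Thm 1.6 (iii) for the open-section case).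
ROUTE: the permutation-module Fox calculus of `DehnTwistFoxSplitExtension` (p486052) [cite: LyndonSchupp2001, Ch. II §3].
In a finite quotient `ψ : F̂₂ → G` (`β = ψb` of order `o`, `Q ∋ β, αβα⁻¹`, modulus `q = d·o`, `S = (G/Q → ℤ/q) ⋊ G`,
exponent `e` with `d ∣ e`) the `o`-th power of the mixed twist fixes `x` and is trivial on `G`; comparing
`E₀ ∘ (conj(b^{u})∘shear^i(k))^o` with `E₀` (`a ↦ (1,α)`, `b ↦ (δ_Q,β)`) by the product rule gives
`D₁^U · D_α^M · D_α^{-U} = 1` for the Fox derivatives `D₁ = (E₁x).left`, `D_α = (E_αx).left` (`U = o·(u mod e)`,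
`M = o·(k^i mod e)`); the fundamental formula `D_α = D₁ · δ_Q⁻¹δ_{ψxQ}` turns this, at the coset `ψx·Q ≠ Q`, into
`U ≡ M·(t+1) (mod q)`, whence `u mod d ∈ (k^i mod d)·ℤ/d = 0` — contradicting the choice of `d`.  So `ψx ∈ Q` for
EVERY subgroup `Q ∋ ψb` (no involution `θ` and no `αβα⁻¹ ∈ Q` needed here: the mixed relation carries two independent
coefficients); taking `Q` = the image of `b^Ẑ` in `F̂₂/U` and `⋂_U b^Ẑ U = b^Ẑ` gives `x ∈ Π_e`.
HONEST FRAMING: classical profinite group theory at a constructed model (constructed ≠ geometric); CT2a only — the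
integral-slope half of CT2 is NOT claimed; nothing here bears on [IUTchIII] Cor 3.12; no side taken.
-/

noncomputable section

open scoped Pointwise

namespace Literature.AnabelianGeometry.AbsoluteAnabelian.AbsTopII.DehnTwist

open Literature.AnabelianGeometry.EtaleTheta.SettingModel
open Literature.AnabelianGeometry.EtaleTheta
open Literature.AnabelianGeometry.SemiGraphs.SemiGraphOfAnabelioids.IsProSigmaCompletion (zhat_monoidHom_apply_eq_pow)
open Function _root_.Topology

/-! ### §1 Two more Fox-calculus rules: trivial and inverse derivatives -/

section SplitExtension

variable {N G : Type} [CommGroup N] [Group G] {φ : G →* MulAut N}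
  [TopologicalSpace (N ⋊[φ] G)] [DiscreteTopology (N ⋊[φ] G)]

/-- A continuous `E : F̂₂ → N ⋊ G` with trivial `N`-components on `a`, `b` has trivial `N`-component everywhere.
[cite: LyndonSchupp2001, Ch. II §3] -/
theorem left_eq_one_of_gens (E : F₂hatT →ₜ* N ⋊[φ] G) (ha : (E genA).left = 1) (hb : (E genB).left = 1)
    (y : F₂hatT) : (E y).left = 1 := by
  let r : (N ⋊[φ] G) →ₜ* (N ⋊[φ] G) :=
    ⟨(SemidirectProduct.inr : G →* N ⋊[φ] G).comp SemidirectProduct.rightHom, continuous_of_discreteTopology⟩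
  have hgen : ∀ s : N ⋊[φ] G, s.left = 1 → SemidirectProduct.inr s.right = s := fun s hs => by
    ext
    · rw [SemidirectProduct.left_inr, hs]
    · rw [SemidirectProduct.right_inr]
  have h := ext_of_eta (f := r.comp E) (f' := E) (hgen _ ha) (hgen _ hb)
  have hy := DFunLike.congr_fun h y
  change SemidirectProduct.inr (E y).right = E y at hy
  rw [← hy, SemidirectProduct.left_inr]

/-- **Inverse rule.**  If `E, E'` have the same `G`-components and inverse `N`-components on the generators, then
`(E' y).left = ((E y).left)⁻¹` everywhere. [cite: LyndonSchupp2001, Ch. II §3] -/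
theorem left_eq_inv_left_of_gens [Finite (N ⋊[φ] G)] (E E' : F₂hatT →ₜ* N ⋊[φ] G)
    (ha' : (E' genA).right = (E genA).right) (hb' : (E' genB).right = (E genB).right)
    (hla : (E' genA).left = ((E genA).left)⁻¹) (hlb : (E' genB).left = ((E genB).left)⁻¹) (y : F₂hatT) :
    (E' y).left = ((E y).left)⁻¹ := by
  obtain ⟨EI, hIa, hIb⟩ := exists_ext_semidirect (SemidirectProduct.inr (E genA).right : N ⋊[φ] G)
    (SemidirectProduct.inr (E genB).right)
  have hprod := left_eq_pow_mul_left_of_gens E E' EI 1 ha' hb' (by rw [hIa, SemidirectProduct.right_inr])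
    (by rw [hIb, SemidirectProduct.right_inr]) (by rw [hIa, SemidirectProduct.left_inr, hla, pow_one, inv_mul_cancel])
    (by rw [hIb, SemidirectProduct.left_inr, hlb, pow_one, inv_mul_cancel]) y
  have h1 : (EI y).left = 1 :=
    left_eq_one_of_gens EI (by rw [hIa, SemidirectProduct.left_inr]) (by rw [hIb, SemidirectProduct.left_inr]) y
  rw [h1, pow_one] at hprod
  exact eq_inv_of_mul_eq_one_left hprod.symm

end SplitExtension

/-! ### §2 Iterating a mixed twist -/

/-- Powers of a mixed twist: if `shear^i(k) x = b^{-u} x b^u` then `shear^i(k^m) x = b^{-u^m} x b^{u^m}` (the twist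
fixes `b^Ẑ`). [cite: MochizukiAbsTopII2013, Prop 1.3 (viii) p.12] -/
theorem shearPow_pow_eq_conj_of_eq (i : ℕ) {u k : ZH} {x : F₂hatT}
    (hx : shearPow i k x = (bPow u)⁻¹ * x * bPow u) (m : ℕ) :
    shearPow i (k ^ m) x = (bPow (u ^ m))⁻¹ * x * bPow (u ^ m) := by
  induction m with
  | zero => rw [pow_zero, pow_zero, map_one, MulAut.one_apply, map_one, inv_one, one_mul, mul_one]
  | succ m ih =>
    rw [pow_succ, map_mul, MulAut.mul_apply, hx, map_mul, map_mul, map_inv, shearPow_bPow, ih, pow_succ, map_mul]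
    group

/-! ### §3 CT2a in one finite quotient -/

/-- **CT2a at one finite quotient.**  `ψ : F̂₂ → G` finite, `Q ∋ ψb` (ANY such subgroup); a level `d` with
`k^i ≡ 0`, `u ≢ 0 (mod d)`; `shear^i(k) x = b^{-u} x b^u`.  Then `ψ x ∈ Q`. [cite: MochizukiAbsTopII2013, Prop 1.3 (viii) p.12] -/
theorem map_mem_of_mixed_twist_eq {i : ℕ} {G : Type} [Group G] [Finite G] [TopologicalSpace G] [DiscreteTopology G]
    (ψ : F₂hatT →ₜ* G) (Q : Subgroup G) (hβ : ψ genB ∈ Q)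
    {u k : ZH} {d : ℕ+} (hdk : ZHatLevel.level d (k ^ i) = 1) (hdu : ZHatLevel.level d u ≠ 1)
    {x : F₂hatT} (hx : shearPow i k x = (bPow u)⁻¹ * x * bPow u) : ψ x ∈ Q := by
  classical
  set α := ψ genA with hα
  set β := ψ genB with hβdef
  set o : ℕ := orderOf β with ho
  have ho0 : 0 < o := orderOf_pos β
  have hβo : β ^ o = 1 := pow_orderOf_eq_one β
  -- the modulus `q = d · o` and the finite split extension `S`
  set q : ℕ := d * o with hq
  haveI : NeZero q := ⟨Nat.pos_iff_ne_zero.mp (Nat.mul_pos d.pos ho0)⟩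
  letI : TopologicalSpace ((G ⧸ Q → Multiplicative (ZMod q)) ⋊[mulAutArrow] G) := ⊥
  haveI : DiscreteTopology ((G ⧸ Q → Multiplicative (ZMod q)) ⋊[mulAutArrow] G) := ⟨rfl⟩
  haveI : Finite ((G ⧸ Q → Multiplicative (ZMod q)) ⋊[mulAutArrow] G) :=
    Finite.of_equiv _ (SemidirectProduct.equivProd).symm
  set c : ℕ := Nat.card ((G ⧸ Q → Multiplicative (ZMod q)) ⋊[mulAutArrow] G) with hc
  have hc0 : 0 < c := Nat.card_pos
  set m' : ℕ+ := ⟨o * c, Nat.mul_pos ho0 hc0⟩ with hm'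
  have he : ∀ s : (G ⧸ Q → Multiplicative (ZMod q)) ⋊[mulAutArrow] G, s ^ ((d * m' : ℕ+) : ℕ) = 1 := by
    intro s
    show s ^ ((d : ℕ) * (o * c)) = 1
    rw [← mul_assoc, mul_comm, pow_mul, pow_card_eq_one', one_pow]
  set nu : ℕ := (Multiplicative.toAdd (ZHatLevel.level (d * m') u)).val with hnu
  set nk : ℕ := (Multiplicative.toAdd (ZHatLevel.level (d * m') (k ^ i))).val with hnk
  -- the Fox homomorphisms
  set d1 : G ⧸ Q → Multiplicative (ZMod q) := Pi.mulSingle ((1 : G) : G ⧸ Q) (Multiplicative.ofAdd 1) with hd1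
  set dα : G ⧸ Q → Multiplicative (ZMod q) := Pi.mulSingle ((α : G) : G ⧸ Q) (Multiplicative.ofAdd 1) with hdα
  have hαd1 : (mulAutArrow α : MulAut (G ⧸ Q → Multiplicative (ZMod q))) d1 = dα := by
    rw [hd1, mulAutArrow_mulSingle, mul_one]
  have hβd1 : (mulAutArrow β : MulAut (G ⧸ Q → Multiplicative (ZMod q))) d1 = d1 := by
    rw [hd1, mulAutArrow_mulSingle, mul_one, mulSingle_coe_eq_of_mem Q q hβ]
  obtain ⟨E₀, h0a, h0b⟩ := exists_ext_semidirect
    (SemidirectProduct.inr α : (G ⧸ Q → Multiplicative (ZMod q)) ⋊[mulAutArrow] G) ⟨d1, β⟩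
  obtain ⟨E1, h1a, h1b⟩ := exists_ext_semidirect
    (⟨d1, α⟩ : (G ⧸ Q → Multiplicative (ZMod q)) ⋊[mulAutArrow] G) (SemidirectProduct.inr β)
  obtain ⟨EA, hAa, hAb⟩ := exists_ext_semidirect
    (⟨dα, α⟩ : (G ⧸ Q → Multiplicative (ZMod q)) ⋊[mulAutArrow] G) (SemidirectProduct.inr β)
  obtain ⟨EA', hA'a, hA'b⟩ := exists_ext_semidirect
    (⟨dα⁻¹, α⟩ : (G ⧸ Q → Multiplicative (ZMod q)) ⋊[mulAutArrow] G) (SemidirectProduct.inr β)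
  obtain ⟨EB, hBa, hBb⟩ := exists_ext_semidirect
    (⟨d1⁻¹, α⟩ : (G ⧸ Q → Multiplicative (ZMod q)) ⋊[mulAutArrow] G) (SemidirectProduct.inr β)
  -- inverse rules
  have hA' : ∀ y, (EA' y).left = ((EA y).left)⁻¹ := left_eq_inv_left_of_gens EA EA' (by rw [hA'a, hAa])
    (by rw [hA'b, hAb]) (by rw [hA'a, hAa]) (by rw [hA'b, hAb, SemidirectProduct.left_inr, inv_one])
  have hB' : ∀ y, (EB y).left = ((E1 y).left)⁻¹ := left_eq_inv_left_of_gens E1 EB (by rw [hBa, h1a])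
    (by rw [hBb, h1b]) (by rw [hBa, h1a]) (by rw [hBb, h1b, SemidirectProduct.left_inr, inv_one])
  -- powers of `b` under `E₀`
  have hcomm : Commute (SemidirectProduct.inl d1 : (G ⧸ Q → Multiplicative (ZMod q)) ⋊[mulAutArrow] G)
      (SemidirectProduct.inr β) := by
    have h := SemidirectProduct.inl_aut (φ := (mulAutArrow : G →* MulAut (G ⧸ Q → Multiplicative (ZMod q)))) β d1
    rw [hβd1] at h
    show SemidirectProduct.inl d1 * SemidirectProduct.inr β = SemidirectProduct.inr β * SemidirectProduct.inl d1
    calc SemidirectProduct.inl d1 * SemidirectProduct.inr β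
        = SemidirectProduct.inr β * SemidirectProduct.inl d1 * SemidirectProduct.inr β⁻¹ *
            SemidirectProduct.inr β := by rw [← h]
      _ = SemidirectProduct.inr β * SemidirectProduct.inl d1 := by
          rw [mul_assoc, ← map_mul, inv_mul_cancel, map_one, mul_one]
  have h0b' : E₀ genB = SemidirectProduct.inl d1 * SemidirectProduct.inr β := by
    rw [h0b, SemidirectProduct.mk_eq_inl_mul_inr]
  have hpow : ∀ t : ZH, E₀ (bPow t) = (E₀ genB) ^ (Multiplicative.toAdd (ZHatLevel.level (d * m') t)).val := by
    intro t
    have h := zhat_monoidHom_apply_eq_pow (E₀.toMonoidHom.comp bPow.toMonoidHom) (d * m') he t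
    change E₀ (bPow t) = E₀ (bPow (ZHatLevel.eta 1)) ^ _ at h
    rw [← iotaZ_one_eq, bPow_iotaZ_one] at h
    exact h
  have hpowo : ∀ (t : ZH) (n : ℕ), n = (Multiplicative.toAdd (ZHatLevel.level (d * m') t)).val →
      E₀ (bPow (t ^ o)) = SemidirectProduct.inl (d1 ^ (o * n)) := by
    intro t n hn
    rw [map_pow, map_pow, hpow t, ← hn, ← pow_mul, mul_comm n o, h0b', hcomm.mul_pow, ← map_pow, ← map_pow,
      pow_mul β o n, hβo, one_pow, map_one, mul_one]
  -- the `o`-th power of the mixed twist, as a continuous endomorphism, fixes `x`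
  let conjC : F₂hatT →ₜ* F₂hatT :=
    ⟨(MulAut.conj (bPow (u ^ o))).toMonoidHom, (continuous_const.mul continuous_id).mul continuous_const⟩
  let E₁ : F₂hatT →ₜ* (G ⧸ Q → Multiplicative (ZMod q)) ⋊[mulAutArrow] G :=
    E₀.comp (conjC.comp (shearEnd ((k ^ o) ^ i)))
  have hE₁ : ∀ y, E₁ y = E₀ (bPow (u ^ o) * shearPow i (k ^ o) y * (bPow (u ^ o))⁻¹) := fun y => rfl
  have hE₁x : E₁ x = E₀ x := by
    rw [hE₁, shearPow_pow_eq_conj_of_eq i hx o]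
    congr 1
    group
  have hαpow : ∀ n : ℕ, (mulAutArrow α : MulAut (G ⧸ Q → Multiplicative (ZMod q))) (d1 ^ n) = dα ^ n :=
    fun n => by rw [map_pow, hαd1]
  have hβpow : ∀ n : ℕ, (mulAutArrow β : MulAut (G ⧸ Q → Multiplicative (ZMod q))) (d1 ^ n) = d1 ^ n :=
    fun n => by rw [map_pow, hβd1]
  have h1a' : E₁ genA = ⟨d1 ^ (o * nu) * (dα ^ (o * nk) * (dα ^ (o * nu))⁻¹), α⟩ := by
    rw [hE₁, show shearPow i (k ^ o) genA = genA * bPow ((k ^ o) ^ i) from shear_eta_of_zero _, map_mul, map_mul,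
      map_mul, map_inv, ← pow_right_comm, hpowo u nu hnu, hpowo (k ^ i) nk hnk,
      show E₀ genA = SemidirectProduct.inr α from h0a]
    refine SemidirectProduct.ext ?_ ?_
    · simp only [SemidirectProduct.mul_left, SemidirectProduct.inv_left, SemidirectProduct.left_inl,
        SemidirectProduct.right_inl, SemidirectProduct.left_inr, SemidirectProduct.right_inr,
        map_one, MulAut.one_apply, one_mul, inv_one, map_mul, map_inv, hαpow, mul_assoc]
    · simp only [SemidirectProduct.mul_right, SemidirectProduct.inv_right, SemidirectProduct.right_inl,
        SemidirectProduct.right_inr, one_mul, mul_one, inv_one]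
  have h1b' : E₁ genB = E₀ genB := by
    rw [hE₁, show shearPow i (k ^ o) genB = genB from shearPow_eta_one i _, map_mul, map_mul, map_inv,
      hpowo u nu hnu, h0b]
    refine SemidirectProduct.ext ?_ ?_
    · simp only [SemidirectProduct.mul_left, SemidirectProduct.inv_left, SemidirectProduct.left_inl,
        SemidirectProduct.right_inl, SemidirectProduct.mul_right, map_one, MulAut.one_apply, one_mul, inv_one,
        map_inv, hβpow]
      group
    · simp only [SemidirectProduct.mul_right, SemidirectProduct.inv_right, SemidirectProduct.right_inl, one_mul,
        mul_one, inv_one]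
  -- the product rule, three times
  obtain ⟨F1, hF1a, hF1b⟩ := exists_ext_semidirect
    (⟨(dα ^ (o * nu))⁻¹, α⟩ : (G ⧸ Q → Multiplicative (ZMod q)) ⋊[mulAutArrow] G) ⟨d1, β⟩
  obtain ⟨F2, hF2a, hF2b⟩ := exists_ext_semidirect
    (⟨dα ^ (o * nk) * (dα ^ (o * nu))⁻¹, α⟩ : (G ⧸ Q → Multiplicative (ZMod q)) ⋊[mulAutArrow] G) ⟨d1, β⟩
  have hp1 := left_eq_pow_mul_left_of_gens E₀ EA' F1 (o * nu) (by rw [hA'a, h0a]; rfl) (by rw [hA'b, h0b]; rfl)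
    (by rw [hF1a, h0a]; rfl) (by rw [hF1b, h0b]) (by rw [hF1a, hA'a, h0a]; simp) (by rw [hF1b, hA'b, h0b]; simp) x
  have hp2 := left_eq_pow_mul_left_of_gens F1 EA F2 (o * nk) (by rw [hAa, hF1a]) (by rw [hAb, hF1b]; rfl)
    (by rw [hF2a, hF1a]) (by rw [hF2b, hF1b]) (by rw [hF2a, hAa, hF1a]) (by rw [hF2b, hAb, hF1b]; simp) x
  have hp3 := left_eq_pow_mul_left_of_gens F2 E1 E₁ (o * nu) (by rw [h1a, hF2a]) (by rw [h1b, hF2b]; rfl)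
    (by rw [h1a', hF2a]) (by rw [h1b', hF2b, h0b]) (by rw [h1a', h1a, hF2a]) (by rw [h1b', h1b, hF2b, h0b]; simp) x
  rw [hE₁x, hp2, hp1, hA'] at hp3
  -- `hp3 : (E₀ x).left = (E1 x).left ^ U * ((EA x).left ^ M * (((EA x).left)⁻¹ ^ U * (E₀ x).left))`
  have key : (E1 x).left ^ (o * nu) * (EA x).left ^ (o * nk) * ((EA x).left)⁻¹ ^ (o * nu) = 1 := by
    have h := hp3.symm
    rw [inv_pow, ← mul_assoc, ← mul_assoc] at h
    rw [inv_pow]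
    exact mul_right_cancel (h.trans (one_mul _).symm)
  -- the fundamental formula: `(EA x).left = (E1 x).left * (d1⁻¹ * δ_{ψx})`
  let Λ : F₂hatT →ₜ* (G ⧸ Q → Multiplicative (ZMod q)) ⋊[mulAutArrow] G :=
    { toMonoidHom := ((MulAut.conj (SemidirectProduct.inl d1)⁻¹).toMonoidHom.comp
        (SemidirectProduct.inr : G →* (G ⧸ Q → Multiplicative (ZMod q)) ⋊[mulAutArrow] G)).comp ψ.toMonoidHom
      continuous_toFun := by
        exact (continuous_of_discreteTopology (f := fun g : G =>
          (MulAut.conj (SemidirectProduct.inl d1)⁻¹ :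
            MulAut ((G ⧸ Q → Multiplicative (ZMod q)) ⋊[mulAutArrow] G)) (SemidirectProduct.inr g))).comp
          ψ.continuous }
  have hΛ : ∀ y, Λ y = ⟨d1⁻¹ * Pi.mulSingle ((ψ y : G) : G ⧸ Q) (Multiplicative.ofAdd 1), ψ y⟩ := by
    intro y
    show (SemidirectProduct.inl d1)⁻¹ * SemidirectProduct.inr (ψ y) * (SemidirectProduct.inl d1)⁻¹⁻¹ = _
    rw [inv_inv, ← map_inv, ← SemidirectProduct.mk_eq_inl_mul_inr]
    ext
    · simp only [SemidirectProduct.mul_left, SemidirectProduct.left_inl]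
      rw [hd1, mulAutArrow_mulSingle, mul_one]
    · simp only [SemidirectProduct.mul_right, SemidirectProduct.right_inl, mul_one]
  have hprodΛ := left_eq_pow_mul_left_of_gens EA EB Λ 1 (by rw [hBa, hAa]) (by rw [hBb, hAb])
    (by rw [hΛ, hAa]) (by rw [hΛ, hAb]; rfl) (by rw [hΛ, hBa, hAa, pow_one, hdα, hα])
    (by rw [hΛ, hBb, hAb, pow_one, SemidirectProduct.left_inr, one_mul, ← hβdef, mulSingle_coe_eq_of_mem Q q hβ,
          ← hd1, inv_mul_cancel]) x
  rw [pow_one, hB', hΛ] at hprodΛ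
  change d1⁻¹ * Pi.mulSingle ((ψ x : G) : G ⧸ Q) (Multiplicative.ofAdd 1) = ((E1 x).left)⁻¹ * (EA x).left
    at hprodΛ
  -- evaluate at the coset `ψx · Q`, assuming it is not `Q`
  by_contra hxQ
  have hne : ((ψ x : G) : G ⧸ Q) ≠ ((1 : G) : G ⧸ Q) := by
    intro h
    rw [QuotientGroup.eq, mul_one] at h
    exact hxQ ((Q.inv_mem_iff).mp h)
  set t : ZMod q := Multiplicative.toAdd ((E1 x).left ((ψ x : G) : G ⧸ Q)) with ht
  have hAval : (EA x).left ((ψ x : G) : G ⧸ Q) = Multiplicative.ofAdd (t + 1) := by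
    have h := congr_fun hprodΛ ((ψ x : G) : G ⧸ Q)
    rw [Pi.mul_apply, Pi.mul_apply, Pi.inv_apply, Pi.inv_apply, hd1, Pi.mulSingle_eq_of_ne hne, inv_one, one_mul,
      Pi.mulSingle_eq_same] at h
    rw [← mul_inv_cancel_left ((E1 x).left ((ψ x : G) : G ⧸ Q)) ((EA x).left ((ψ x : G) : G ⧸ Q)), ← h, ht,
      ofAdd_add, ofAdd_toAdd]
  have hval := congr_fun key ((ψ x : G) : G ⧸ Q)
  rw [Pi.mul_apply, Pi.mul_apply, Pi.pow_apply, Pi.pow_apply, Pi.pow_apply, Pi.inv_apply, hAval, Pi.one_apply,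
    ← ofAdd_toAdd ((E1 x).left ((ψ x : G) : G ⧸ Q)), ← ht] at hval
  have hlin : ((o * nu : ℕ) : ZMod q) = ((o * nk : ℕ) : ZMod q) * (t + 1) := by
    have h := congrArg Multiplicative.toAdd hval
    simp only [toAdd_mul, toAdd_pow, toAdd_inv, toAdd_ofAdd, toAdd_one, nsmul_eq_mul] at h
    linear_combination (-1 : ZMod q) * h
  -- arithmetic: `o·nu ≡ o·nk·s (mod d·o)` forces `nu ≡ nk·s (mod d)`, but `nk ≡ 0`, `nu ≢ 0 (mod d)`
  set s : ℕ := (t + 1).val with hs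
  have hs' : ((s : ℕ) : ZMod q) = t + 1 := ZMod.natCast_zmod_val (t + 1)
  rw [← hs', ← Nat.cast_mul, ZMod.natCast_eq_natCast_iff, hq, mul_comm (d : ℕ) o, mul_assoc] at hlin
  have hmod : nu ≡ nk * s [MOD d] := Nat.ModEq.mul_left_cancel' ho0.ne' hlin
  have hcast : ∀ (w : ZH) (n : ℕ), n = (Multiplicative.toAdd (ZHatLevel.level (d * m') w)).val →
      ((n : ℕ) : ZMod d) = Multiplicative.toAdd (ZHatLevel.level d w) := by
    intro w n hn
    have h := ZHatLevel.cast_level_mul d m' w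
    rw [ZMod.castHom_apply, ZMod.cast_eq_val] at h
    rw [hn]
    exact h
  apply hdu
  have h1 : ((nu : ℕ) : ZMod d) = 0 := by
    rw [(ZMod.natCast_eq_natCast_iff _ _ _).mpr hmod, Nat.cast_mul, hcast (k ^ i) nk hnk, hdk, toAdd_one, zero_mul]
  rw [← ofAdd_toAdd (ZHatLevel.level d u), ← hcast u nu hnu, h1, ofAdd_zero]

/-! ### §4 CT2a: compactness -/

/-- **CT2a — the non-integral-slope half of CT2.**  If some level `d` of `Ẑ` kills `k^i` but not `u` (so `u ∉ (k^i)·Ẑ`,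
in particular `b^u ∉ {1, b^{k^i}}`), then `shear^i(k) x = b^{-u} x b^u ⇒ x ∈ Π_e = b^Ẑ` (finite quotients `F̂₂/U` with
`Q` the image of `b^Ẑ`, and `⋂_U b^Ẑ U = b^Ẑ`). [cite: MochizukiAbsTopII2013, Prop 1.3 (viii) p.12] -/
theorem mem_nodeGp_of_mixed_twist_eq {i : ℕ} {u k : ZH} {d : ℕ+} (hdk : ZHatLevel.level d (k ^ i) = 1)
    (hdu : ZHatLevel.level d u ≠ 1) {x : F₂hatT} (hx : shearPow i k x = (bPow u)⁻¹ * x * bPow u) :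
    x ∈ nodeGp := by
  classical
  show x ∈ bAxis
  by_contra hxv
  set T : Set F₂hatT := (fun v : F₂hatT => v⁻¹ * x) '' (bAxis : Set F₂hatT) with hT
  have hcl : IsClosed (bAxis : Set F₂hatT) := isClosed_bAxis
  have hTc : IsCompact T := hcl.isCompact.image (continuous_inv.mul continuous_const)
  have h1T : (1 : F₂hatT) ∈ Tᶜ := by
    rintro ⟨v, hv, hvx⟩
    apply hxv
    have : x = v := by
      have h := hvx
      rw [inv_mul_eq_one] at h
      exact h.symm
    rw [this]
    exact hv
  obtain ⟨U, hU⟩ := ProfiniteGrp.exist_openNormalSubgroup_sub_open_nhds_of_one hTc.isClosed.isOpen_compl h1T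
  haveI : Finite (F₂hatT ⧸ U.toSubgroup) := Subgroup.quotient_finite_of_isOpen _ U.toOpenSubgroup.isOpen
  haveI : DiscreteTopology (F₂hatT ⧸ U.toSubgroup) := QuotientGroup.discreteTopology U.toOpenSubgroup.isOpen
  let ψ : F₂hatT →ₜ* F₂hatT ⧸ U.toSubgroup := ⟨QuotientGroup.mk' U.toSubgroup, QuotientGroup.continuous_mk⟩
  let Qb : Subgroup (F₂hatT ⧸ U.toSubgroup) := bAxis.map (QuotientGroup.mk' U.toSubgroup)
  have hβ : ψ genB ∈ Qb := Subgroup.mem_map_of_mem _ eta_of_one_mem_bAxis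
  have hmem := map_mem_of_mixed_twist_eq ψ Qb hβ hdk hdu hx
  obtain ⟨v, hv, hvx⟩ := Subgroup.mem_map.mp hmem
  have hvU : v⁻¹ * x ∈ U := QuotientGroup.eq.mp hvx
  exact hU hvU ⟨v, hv, rfl⟩

/-- **CT2 holds OFF the integral slopes**: in the binder shape of `prop_1_3_viii'_dpsc_of_CT2`, every instance of CT2
whose slope parameter `u` is NOT a `Ẑ`-multiple of `k^i` at some finite level is a theorem; the residual of GAP row
G-L4t6g8-2 is the integral-slope case only. [cite: MochizukiAbsTopII2013, Prop 1.3 (viii) p.12] -/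
theorem CT2_of_nonintegral (i : ℕ) (u k : ZH) (x : F₂hatT)
    (hd : ∃ d : ℕ+, ZHatLevel.level d (k ^ i) = 1 ∧ ZHatLevel.level d u ≠ 1)
    (hx : shearPow i k x = (bPow u)⁻¹ * x * bPow u) : x ∈ nodeGp := by
  obtain ⟨d, hdk, hdu⟩ := hd
  exact mem_nodeGp_of_mixed_twist_eq hdk hdu hx

end Literature.AnabelianGeometry.AbsoluteAnabelian.AbsTopII.DehnTwist

end
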